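import Summits.BirchSwinnertonDyer.BirchSwinnertonDyer.Theorems.PrintX11aLowerHalfThreePartnerTheoremB
import Summits.BirchSwinnertonDyer.BirchSwinnertonDyer.Theorems.PrintX11aLowerHalfTresRamifieCore
import HarnessLib

/-!
# Crux `X11aLowerHalf` (item stmt-BirchSwinnertonDyer-19064) at `p = 3` WITHOUT the Kodaira road: finite flat ⟶ the THREE-fact
# partner road, très ramifié ⟶ the member-currency research statement — a candidate reshape r14 «drop the Kodaira road»
# (width seat bsd-line-er5-p2 = -w3, p = 3 binder, gen 7; `--supports stmt-BirchSwinnertonDyer-19064` helper; the lead decides)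

HONEST FRAMING.  Five composition theorems; no definition, no named fact minted, no `sorry`.  Every theorem is CONDITIONAL and closes
NOTHING: each hypothesis is DISPLAYED — statement-only named published facts (never proved; the two Emerton–Pollack–Weston odd-prime
partner instances carry the token `EPW06@3-Hida-control`, Yan–Zhu Thm. 4.9 the token `YZ26@3-BF-ERL-Ohta`), K2's OPEN item 19948, Greenberg's
analytic `μ = 0` on the deep SURJECTIVE X11a pairs at `p ≥ 5` (OPEN) and the rational cyclotomic main-conjecture equality at `3` for a member
of `H(E[3])` at EVERY très-ramifié deep X11a pair (OPEN — X. Wan's Thm. 4 shape at `p = 3`, not in print).  The gate records a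
`conditional-result`; the leaf `WAllCornerX11a` is an OPEN `@[conjecture]` and is NOT proved; BSD is proved for no curve and no class.
beyond-print theorem: no.

## What and why (a reshape OFFERED to the lead; nothing provable is added or removed)

Line «birth» r13 (lead bsd-line-x11a-p1 g4, sha16 4bc4cc75a1032e22) cuts the deep X11a pairs at `p = 3` three ways: the Kodaira sub-locus
(`ρ̄` onto ∧ an additive place of type IV/IV*; er5-p2 g3's level-lowered (ram) member — Ribet–DDT additive drop G52, Carayol–Livné G53,
Skinner–Urban 3.6.4 (ram) rational G54, the line's ONLY counting-flagged input `SU14-12.3.6-mu@nonsplit@3`, «no closure counted through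
it»), the finite-flat off-Kodaira pairs (the partner road, THREE facts after p639703) and the très-ramifié off-Kodaira pairs (the member
stub `stub_memberRatEqAtTresRamifieThree`, OPEN).  The three Kodaira-road facts are consumed NOWHERE ELSE on the line.  This file composes
the `p = 3` deep statement and the whole crux along FINITE-FLATNESS ALONE:

* finite flat at `3` (Kodaira or not; 89 of the 448 deep classes with `N < 5·10⁵`) ⟶ the three-fact partner road: a good-ordinary
  `3`-congruent partner exists at EVERY multiplicative peu-ramifié curve (`Birth.exists_goodOrdinary_threeCongruent_partner`, route
  UniversalToricDescent's Hesse-pencil twin, fact-free; no Kodaira hypothesis), then `ClassX11a.missingLowerBoundAt_three_of_partner_of_contraFacts_of_theoremB`;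
* très ramifié at `3` (Kodaira or not; 359 classes in range) ⟶ the member-currency statement WIDENED to the whole très-ramifié deep locus
  (`hM`: drop the off-Kodaira binder; the same open problem), through er5-p2 g6's door
  `ClassX11a.missingLowerBoundAt_three_of_tresRamifie_of_memberRatEqAt_of_facts` (p634533), which takes no Kodaira condition.

Consequences if the lead registers r14 from it: registered stubs 7 → 6 (`stub_suRamFactLower` leaves; `stub_elevenFactsLower` ↦ the NINE
of the eleven that remain consumed, `stub_nineFactsLowerL`; the member stub widened), distinct named facts displayed 24 → 21, no counting-
flagged input left on the line; the 73 Kodaira ∩ très-ramifié classes in range move from «closure modulo a flagged print» to the open core;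
g3's Kodaira doors (p621194, p623401) remain in the tree for the day Skinner–Urban's Prop. 12.3.6 is repaired in print at `3`.  If the lead
keeps r13, this file is only an alternative door.  Theorems: `ThreePartner.lowerThreeDeep_of_partnerFF_of_memberTR_of_facts` (§1),
`Birth.x11aLowerHalf_of_children_r14 : (U3 nine) → (nine of L's eleven) → (THREE partner facts) → 19948 → (stub_muAnSurjDeepFive) → (hM widened)
→ Theses.PrintX11a.X11aLowerHalf` and its `ErratumRoadFive` spelling (§2), `PrintX11aLeaf.cruxes_of_children_r14` ∕ `wAllCornerX11a_of_children_r14` (§3).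

References: [Fisher2012Hessian] Thm. 13.2; [EmertonPollackWeston2006] Thm. 1, Thm. 3.1.1, Thm. 5.1.3, Cor. 5.1.4; [YanZhu2024MainConjNonCM] Thm. 4.9;
[Mazur1978] Cor. 4.1; [MazurTateTeitelbaum1986Invent] §I.10–I.13; [Wan2015] Thm. 4; [Wuthrich2014] Thm. 3, Cor. 18, Lemma 20, Prop. 21;
[Kato2004Asterisque] Thm. 12.4, §17.13; [SteinWuthrich2013] Thm. 6.1; [GreenbergLNM1716] Conj. 1.11; [BalakrishnanEtAl2019] Thm. 1.2;
[Miller2011LMS] Def. 1.1; cell files `Cruxes/X11aLowerHalf/Lines/birth.lean` (r13), `LEAD-g4-VERDICT.md`.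
-/

set_option autoImplicit false
set_option linter.dupNamespace false -- the directory name repeats the summit name (sibling precedent)

noncomputable section

open scoped Classical MatrixGroups ModularForm

open CongruenceSubgroup UpperHalfPlane WeierstrassCurve IsDedekindDomain Rat.HeightOneSpectrum
  Literature.NumberTheory.EllipticCurves
  Literature.NumberTheory.EllipticCurves.ModularForms
  Literature.NumberTheory.EllipticCurves.Rank1Residual
  Literature.NumberTheory.EllipticCurves.Rank1Residual.Typed
  Literature.NumberTheory.EllipticCurves.Wuthrich2014
  Literature.NumberTheory.EllipticCurves.SteinWuthrich2013
  Literature.NumberTheory.EllipticCurves.Greenberg1999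
  Literature.NumberTheory.EllipticCurves.Kato2004
  Literature.NumberTheory.EllipticCurves.GreenbergVatsal2000
  Literature.NumberTheory.EllipticCurves.EmertonPollackWeston2006
  Literature.NumberTheory.EllipticCurves.SkinnerUrban2014
  Literature.NumberTheory.EllipticCurves.BalakrishnanEtAl2019
  Literature.NumberTheory.GaloisRepresentations
  Literature.NumberTheory.Automorphic
  Summit.BirchSwinnertonDyer.Rank1Residual
  Summit.BirchSwinnertonDyer.Rank1Residual.X11a
  Summit.BirchSwinnertonDyer.BirchSwinnertonDyer.Theorems.OddChain

namespace Summit.BirchSwinnertonDyer.BirchSwinnertonDyer.Theorems.ThreePartner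

/-! ### §1 The `p = 3` deep statement along finite-flatness alone -/

/-- **r3's statement `stub_lowerThreeDeep` (the lower half at every deep X11a pair with `p = 3`) WITHOUT the Kodaira road**: finite flat at
`3` ⟶ a good-ordinary `3`-congruent partner at EVERY peu-ramifié multiplicative curve (`Birth.exists_goodOrdinary_threeCongruent_partner`,
fact-free, no Kodaira hypothesis) and the THREE-fact partner road (`…_of_contraFacts_of_theoremB`); très ramifié at `3` ⟶ the member-currency
statement `hM` on the WHOLE très-ramifié deep locus through er5-p2 g6's door (p634533).  Facts: modularity, EPW 3.1.1 ∕ Thm 1 alg ∕ 5.1.3,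
Deligne–Serre 6.1, Hida 3.26, Kato–Wuthrich A32, Kato 12.4 + §17.13 `_contra` ×3, Mazur 4.1, Stein–Wuthrich 6.1 ×2, GZK, GS at odd primes,
EPW Cor. 5.1.4, Yan–Zhu 4.9, EPW Thm. 1 alg mult ⟶ good; Wuthrich's Lemma 20 from the tree.  CONDITIONAL; closes nothing by itself.
[cite: Fisher2012Hessian, Thm. 13.2 (n = 3)] [cite: EmertonPollackWeston2006, Thm. 1, Cor. 5.1.4] [cite: YanZhu2024MainConjNonCM, Thm. 4.9]
[cite: Wan2015, Thm. 4 (pp. 4–5: shape only at p = 3)] [cite: Miller2011LMS, Def. 1.1] -/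
theorem lowerThreeDeep_of_partnerFF_of_memberTR_of_facts
    (hNf : exists_isNewformOf)
    (h311 : thm311_cotorsion_weightK_member_ofLevel_odd) (hT1a : thm1_muAlg_of_weightK_member_ofLevel_odd)
    (hT1b : thm513_transfer_from_weightK_member_of_bdd_ofLevel_odd)
    (h61 : DeligneSerre1974.thm61_exists_adicGaloisRep) (h326 : Hida2000_thm326_ordinary)
    (hKato : kato_charIdeal_dvd_multiplicative_of_surjective)
    (h12 : Kato2004.thm12_4) (hns' : Kato2004.exists_multDivisibilityInputs_nonsplit_contra)
    (hsp' : Kato2004.exists_multDivisibilityInputs_split_contra)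
    (hfine' : Kato2004.exists_multDivisibilityInputs_fine_contra)
    (hMz : mazur_not_dvd_maninConstant_of_odd)
    (hJs : thm61_splitMultiplicative) (hJn : thm61_nonsplitMultiplicative)
    (hGZK : rank_eq_analyticRank_of_analyticRank_le_one)
    (hGS : ∀ (W : WeierstrassCurve ℚ) [W.IsElliptic] [W.IsGloballyMinimal] (p : ℕ) [Fact p.Prime],
      p ≠ 2 → greenberg_stevens (W := W) (p := p))
    (hEPW : cor514_transfer_of_goodOrdinary_odd)
    (hYZ : YanZhu2026.thm49_charIdeal_eq_padicLFunction) (hTa : thm1_muAlg_transfer_goodOrdinary_of_mult_odd)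
    (hM : ∀ (W : WeierstrassCurve ℚ) [W.IsElliptic] [W.IsGloballyMinimal] (p : ℕ) [Fact p.Prime],
      ClassX11a W p → p = 3 → ¬ X11a.ShaAnUnit W p → ¬ p ∣ padicValInt p W.minimalDiscriminantInt → MemberRatEqAt W p) :
    ∀ (W : WeierstrassCurve ℚ) [W.IsElliptic] [W.IsGloballyMinimal] (p : ℕ) [Fact p.Prime],
      ClassX11a W p → p = 3 → ¬ X11a.ShaAnUnit W p → MissingLowerBoundAt W p := by
  intro W _ _ p _ hX hp3 hu
  by_cases hff : p ∣ padicValInt p W.minimalDiscriminantInt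
  · -- finite flat at 3: the Hesse-pencil partner (fact-free, any Kodaira type) and the THREE-fact partner road
    subst hp3
    obtain ⟨A, hAE, hAM, hgoodA, hordA, e, he⟩ :=
      Birth.exists_goodOrdinary_threeCongruent_partner W hX.mult (by exact_mod_cast hff)
    exact hX.missingLowerBoundAt_three_of_partner_of_contraFacts_of_theoremB A hNf hEPW hYZ hTa hMz hKato
      Wuthrich2014.lemma20_surjective_threeAdic_of_semistable_holds h12 hns' hsp' hfine' hJs hJn hGZK (hGS W 3 hX.ne_two) rfl
      hgoodA (by exact_mod_cast hordA) ⟨e, he⟩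
  · -- très ramifié at 3: the member-currency statement on the whole très-ramifié deep locus (er5-p2 g6's door)
    exact hX.missingLowerBoundAt_three_of_tresRamifie_of_memberRatEqAt_of_facts hNf h311 hT1a hT1b h61 h326 hKato
      Wuthrich2014.lemma20_surjective_threeAdic_of_semistable_holds hJs hJn hGZK (hGS W p hX.ne_two) hMz hp3 hff
      (hM W p hX hp3 hu hff)

end Summit.BirchSwinnertonDyer.BirchSwinnertonDyer.Theorems.ThreePartner

namespace Summit.BirchSwinnertonDyer.BirchSwinnertonDyer.Theorems.Birth

/-! ### §2 The whole crux from SIX children (candidate r14) -/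

/-- **Crux L BY NAME from SIX children — candidate r14 «drop the Kodaira road»**: `h9` = the shared nine (U3's text), `h9L` = the NINE of
L's eleven that remain consumed (EPW 3.1.1 ∕ Thm 1 alg ∕ Wan Thm 4 irred ∕ 5.1.3, Deligne–Serre 6.1, Hida 3.26, Kato–Wuthrich A32, GZK, BDMTV —
r10's eleven minus Ribet–DDT @3 and Carayol–Livné), `hQ3` = the THREE partner facts (r13 text), `h48` = item 19948, `hS` =
`stub_muAnSurjDeepFive` (OPEN), `hM` = the member-currency statement on the WHOLE très-ramifié deep locus at `3` (r13's
`stub_memberRatEqAtTresRamifieThree` without its off-Kodaira binder; OPEN).  NO Skinner–Urban (ram) fact.  At `p ≥ 5` verbatim the r7–r13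
body (Wan's member, surjective ∕ contra doors; the both-images certificate from `h48` + `hS` modulo BDMTV); at `p = 3` §1; unit pairs free.
Also a skeleton-level composition: `X11aLowerHalf_of := x11aLowerHalf_erratumRoadFive_of_children_r14 stub_nineFactsOddGS stub_nineFactsLowerL
stub_threePartnerFactsLower stub_twinMuAn stub_muAnSurjDeepFive stub_memberRatEqAtTresRamifieThree'`.  CONDITIONAL; closes nothing; BSD is not proved.
[cite: GreenbergLNM1716, §1 Conj. 1.11 (p. 61)] [cite: Wan2015, Thm. 4 (pp. 4–5)] [cite: EmertonPollackWeston2006, Thm. 1, Cor. 5.1.4]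
[cite: YanZhu2024MainConjNonCM, Thm. 4.9] [cite: BalakrishnanEtAl2019, §1 Thm. 1.2] [cite: Miller2011LMS, Def. 1.1 (arXiv:1010.2431 p. 3)] -/
theorem x11aLowerHalf_of_children_r14
    (h9 : thm61_splitMultiplicative ∧ thm61_nonsplitMultiplicative ∧
      (∀ (W : WeierstrassCurve ℚ) [W.IsElliptic] [W.IsGloballyMinimal] (p : ℕ) [Fact p.Prime],
        p ≠ 2 → greenberg_stevens (W := W) (p := p)) ∧
      Kato2004.thm12_4 ∧ exists_isNewformOf ∧
      Kato2004.exists_multDivisibilityInputs_nonsplit_contra ∧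
      Kato2004.exists_multDivisibilityInputs_split_contra ∧
      Kato2004.exists_multDivisibilityInputs_fine_contra ∧ mazur_not_dvd_maninConstant_of_odd)
    (h9L : thm311_cotorsion_weightK_member_ofLevel_odd ∧ thm1_muAlg_of_weightK_member_ofLevel_odd ∧
      Wan2015.thm4_rational_weightK_member_of_bdd_ofLevel_irred ∧
      thm513_transfer_from_weightK_member_of_bdd_ofLevel_odd ∧
      DeligneSerre1974.thm61_exists_adicGaloisRep ∧ Hida2000_thm326_ordinary ∧
      kato_charIdeal_dvd_multiplicative_of_surjective ∧
      rank_eq_analyticRank_of_analyticRank_le_one ∧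
      thm12_not_le_normalizer_splitCartan)
    (hQ3 : cor514_transfer_of_goodOrdinary_odd ∧ YanZhu2026.thm49_charIdeal_eq_padicLFunction ∧
      thm1_muAlg_transfer_goodOrdinary_of_mult_odd)
    (h48 : Summit.BirchSwinnertonDyer.BirchSwinnertonDyer.Theses.ErratumRoadFive.NonSurjCornerTwinMuAn)
    (hS : ∀ (W : WeierstrassCurve ℚ) [W.IsElliptic] [W.IsGloballyMinimal] (p : ℕ) [Fact p.Prime],
      ClassX11a W p → 5 ≤ p → Surj W p → ¬ X11a.ShaAnUnit W p → X11a.MuAnZeroAt W p)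
    (hM : ∀ (W : WeierstrassCurve ℚ) [W.IsElliptic] [W.IsGloballyMinimal] (p : ℕ) [Fact p.Prime],
      ClassX11a W p → p = 3 → ¬ X11a.ShaAnUnit W p → ¬ p ∣ padicValInt p W.minimalDiscriminantInt → MemberRatEqAt W p) :
    Summit.BirchSwinnertonDyer.BirchSwinnertonDyer.Theses.PrintX11a.X11aLowerHalf := by
  obtain ⟨hJs, hJn, hGS, h12, hNf, hns', hsp', hfine', hMz⟩ := h9
  obtain ⟨h311, hT1a, hT2, hT1b, h61, h326, hKato, hGZK, hB⟩ := h9L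
  obtain ⟨hEPW, hYZ, hTa⟩ := hQ3
  have hcert5 : ∀ (W : WeierstrassCurve ℚ) [W.IsElliptic] [W.IsGloballyMinimal] (p : ℕ) [Fact p.Prime],
      ClassX11a W p → 5 ≤ p → ¬ X11a.ShaAnUnit W p → X11a.MuAnZeroAt W p :=
    muAnDeepFive_of_nonSurjCornerTwinMuAn_of_surjDeep hB h48 hS
  intro W _ _ p hpF hX
  by_cases hu : X11a.ShaAnUnit W p
  · exact x11a_missingLowerBoundAt_of_shaAnUnit hu
  by_cases hp3 : p = 3
  · exact ThreePartner.lowerThreeDeep_of_partnerFF_of_memberTR_of_facts hNf h311 hT1a hT1b h61 h326 hKato h12 hns' hsp' hfine' hMz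
      hJs hJn hGZK hGS hEPW hYZ hTa hM W p hX hp3 hu
  · -- `p ≥ 5`: the certificate + Wan's member + the surjective / contra doors (verbatim the r7–r13 body)
    have hp5 : 5 ≤ p := (Fact.out : p.Prime).five_le_of_ne_two_of_ne_three hX.ne_two hp3
    have hμ : X11a.MuAnZeroAt W p := hcert5 W p hX hp5 hu
    obtain ⟨M, _, hpM, k, g, ι, hmem, hRat⟩ := memberRatEqAt_of_wan_of_five_le W p hNf hT2 hp5 hX.mult hX.irr
    by_cases hsurj : Surj W p
    · have hsurj' : ∀ n : ℕ, W.HasSurjectiveModNGaloisRep (p ^ n : ℕ) :=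
        kato_charIdeal_dvd_multiplicative_of_surjective.surjective_pow_of_five_le W p hp5 hsurj
      exact hX.missingLowerBoundAt_of_member_of_ratEq_of_surjective_pow hNf h311 hT1a hT1b h61 h326 hKato hJs hJn hGZK
        (hGS W p hX.ne_two) hsurj' hμ hpM g ι hmem hRat
    · exact hX.missingLowerBoundAt_of_member_of_ratEq_of_not_surj_contra hNf h311 hT1a hT1b h61 h326 h12 hns' hsp' hfine' hMz
        hJs hJn hGZK (hGS W p hX.ne_two) hsurj hμ hpM g ι hmem hRat

/-- The `ErratumRoadFive` spelling of the six-children composition r14 (one statement under two route names, `Iff.rfl`) — usable as the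
skeleton's `X11aLowerHalf_of`. [cite: Miller2011LMS, Def. 1.1 (arXiv:1010.2431 p. 3)] [cite: Fisher2012Hessian, Thm. 13.2 (n = 3)] -/
theorem x11aLowerHalf_erratumRoadFive_of_children_r14
    (h9 : thm61_splitMultiplicative ∧ thm61_nonsplitMultiplicative ∧
      (∀ (W : WeierstrassCurve ℚ) [W.IsElliptic] [W.IsGloballyMinimal] (p : ℕ) [Fact p.Prime],
        p ≠ 2 → greenberg_stevens (W := W) (p := p)) ∧
      Kato2004.thm12_4 ∧ exists_isNewformOf ∧
      Kato2004.exists_multDivisibilityInputs_nonsplit_contra ∧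
      Kato2004.exists_multDivisibilityInputs_split_contra ∧
      Kato2004.exists_multDivisibilityInputs_fine_contra ∧ mazur_not_dvd_maninConstant_of_odd)
    (h9L : thm311_cotorsion_weightK_member_ofLevel_odd ∧ thm1_muAlg_of_weightK_member_ofLevel_odd ∧
      Wan2015.thm4_rational_weightK_member_of_bdd_ofLevel_irred ∧
      thm513_transfer_from_weightK_member_of_bdd_ofLevel_odd ∧
      DeligneSerre1974.thm61_exists_adicGaloisRep ∧ Hida2000_thm326_ordinary ∧
      kato_charIdeal_dvd_multiplicative_of_surjective ∧
      rank_eq_analyticRank_of_analyticRank_le_one ∧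
      thm12_not_le_normalizer_splitCartan)
    (hQ3 : cor514_transfer_of_goodOrdinary_odd ∧ YanZhu2026.thm49_charIdeal_eq_padicLFunction ∧
      thm1_muAlg_transfer_goodOrdinary_of_mult_odd)
    (h48 : Summit.BirchSwinnertonDyer.BirchSwinnertonDyer.Theses.ErratumRoadFive.NonSurjCornerTwinMuAn)
    (hS : ∀ (W : WeierstrassCurve ℚ) [W.IsElliptic] [W.IsGloballyMinimal] (p : ℕ) [Fact p.Prime],
      ClassX11a W p → 5 ≤ p → Surj W p → ¬ X11a.ShaAnUnit W p → X11a.MuAnZeroAt W p)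
    (hM : ∀ (W : WeierstrassCurve ℚ) [W.IsElliptic] [W.IsGloballyMinimal] (p : ℕ) [Fact p.Prime],
      ClassX11a W p → p = 3 → ¬ X11a.ShaAnUnit W p → ¬ p ∣ padicValInt p W.minimalDiscriminantInt → MemberRatEqAt W p) :
    Summit.BirchSwinnertonDyer.BirchSwinnertonDyer.Theses.ErratumRoadFive.X11aLowerHalf :=
  x11aLowerHalf_of_children_r14 h9 h9L hQ3 h48 hS hM

end Summit.BirchSwinnertonDyer.BirchSwinnertonDyer.Theorems.Birth

namespace Summit.BirchSwinnertonDyer.BirchSwinnertonDyer.Theorems.PrintX11aLeaf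

/-! ### §3 The route's three open cruxes + parent, and the leaf, from the six children r14 -/

/-- **Route `PrintX11a`'s three open cruxes — L (19064), U3 (20613), U5 (20614) — and the parent 20406, BY NAME, from the six children of
candidate r14**: L by `Birth.x11aLowerHalf_of_children_r14`, U3 by `upperNonSurjThree_of_nineFacts_oddGS_glue` (p625569) from `h9` alone, U5 and
the parent by `upperNonSurjFive_of_nonSurjCornerTwinMuAn_of_nineFactsOddGS_glue₃` ∕ `x11aNonSurjEulerHalf_of_nonSurjCornerTwinMuAn_of_nineFactsOddGS`
(p630615; BDMTV = the last conjunct of `h9L`).  CONDITIONAL; closes nothing; BSD is proved for no curve.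
[cite: GreenbergLNM1716, §1 Conj. 1.11 (p. 61)] [cite: Kato2004Asterisque, Thm. 12.4 (p. 221), §17.13 (pp. 279–280)]
[cite: SteinWuthrich2013, Thm. 6.1 (p. 20)] [cite: BalakrishnanEtAl2019, §1 Thm. 1.2] [cite: Miller2011LMS, Def. 1.1] -/
theorem cruxes_of_children_r14
    (h9 : thm61_splitMultiplicative ∧ thm61_nonsplitMultiplicative ∧
      (∀ (W : WeierstrassCurve ℚ) [W.IsElliptic] [W.IsGloballyMinimal] (p : ℕ) [Fact p.Prime],
        p ≠ 2 → greenberg_stevens (W := W) (p := p)) ∧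
      Kato2004.thm12_4 ∧ exists_isNewformOf ∧
      Kato2004.exists_multDivisibilityInputs_nonsplit_contra ∧
      Kato2004.exists_multDivisibilityInputs_split_contra ∧
      Kato2004.exists_multDivisibilityInputs_fine_contra ∧ mazur_not_dvd_maninConstant_of_odd)
    (h9L : thm311_cotorsion_weightK_member_ofLevel_odd ∧ thm1_muAlg_of_weightK_member_ofLevel_odd ∧
      Wan2015.thm4_rational_weightK_member_of_bdd_ofLevel_irred ∧
      thm513_transfer_from_weightK_member_of_bdd_ofLevel_odd ∧
      DeligneSerre1974.thm61_exists_adicGaloisRep ∧ Hida2000_thm326_ordinary ∧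
      kato_charIdeal_dvd_multiplicative_of_surjective ∧
      rank_eq_analyticRank_of_analyticRank_le_one ∧
      thm12_not_le_normalizer_splitCartan)
    (hQ3 : cor514_transfer_of_goodOrdinary_odd ∧ YanZhu2026.thm49_charIdeal_eq_padicLFunction ∧
      thm1_muAlg_transfer_goodOrdinary_of_mult_odd)
    (h48 : Summit.BirchSwinnertonDyer.BirchSwinnertonDyer.Theses.ErratumRoadFive.NonSurjCornerTwinMuAn)
    (hS : ∀ (W : WeierstrassCurve ℚ) [W.IsElliptic] [W.IsGloballyMinimal] (p : ℕ) [Fact p.Prime],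
      ClassX11a W p → 5 ≤ p → Surj W p → ¬ X11a.ShaAnUnit W p → X11a.MuAnZeroAt W p)
    (hM : ∀ (W : WeierstrassCurve ℚ) [W.IsElliptic] [W.IsGloballyMinimal] (p : ℕ) [Fact p.Prime],
      ClassX11a W p → p = 3 → ¬ X11a.ShaAnUnit W p → ¬ p ∣ padicValInt p W.minimalDiscriminantInt → MemberRatEqAt W p) :
    Summit.BirchSwinnertonDyer.BirchSwinnertonDyer.Theses.PrintX11a.X11aLowerHalf ∧
      Summit.BirchSwinnertonDyer.BirchSwinnertonDyer.Theses.PrintX11a.UpperNonSurjThree ∧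
      Summit.BirchSwinnertonDyer.BirchSwinnertonDyer.Theses.PrintX11a.UpperNonSurjFive ∧
      Summit.BirchSwinnertonDyer.BirchSwinnertonDyer.Theses.PrintX11a.X11aNonSurjEulerHalf := by
  obtain ⟨hJs, hJn, hGS, h12, hnf, hns', hsp', hfine', hMz⟩ := h9
  have hB : thm12_not_le_normalizer_splitCartan := h9L.2.2.2.2.2.2.2.2
  exact ⟨Birth.x11aLowerHalf_of_children_r14 ⟨hJs, hJn, hGS, h12, hnf, hns', hsp', hfine', hMz⟩ h9L hQ3 h48 hS hM,
    upperNonSurjThree_of_nineFacts_oddGS_glue ⟨hJs, hJn, hGS, h12, hnf, hns', hsp', hfine', hMz⟩,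
    upperNonSurjFive_of_nonSurjCornerTwinMuAn_of_nineFactsOddGS_glue₃ h48 hB ⟨hJs, hJn, hGS, h12, hnf, hns', hsp', hfine', hMz⟩,
    x11aNonSurjEulerHalf_of_nonSurjCornerTwinMuAn_of_nineFactsOddGS hB h48 hJs hJn hGS h12 hnf hns' hsp' hfine' hMz⟩

/-- **The registered leaf `WAllCornerX11a` (rung W-ALL ∕ 11) DISPLAYED modulo the six children of candidate r14 and Wuthrich 2014 Prop. 21**:
in the kernel the class theorem of leaf X11a holds MODULO twenty-two named published facts (no counting-flagged one; EPW Cor. 5.1.4 ∕ Thm. 1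
alg and Yan–Zhu 4.9 with @3 tokens), K2's item 19948 and two OPEN statements (`hS`, `hM`).  CONDITIONAL: the conclusion is an OPEN
`@[conjecture]` leaf and is NOT proved here; the gate records a `conditional-result`; PARTITION 0; BSD is proved for no class.
[cite: Miller2011LMS, Def. 1.1 (arXiv:1010.2431 p. 3)] [cite: Wuthrich2014, Prop. 21 (p. 400)] [cite: GreenbergLNM1716, §1 Conj. 1.11 (p. 61)]
[cite: Fisher2012Hessian, Thm. 13.2 (n = 3)] -/
theorem wAllCornerX11a_of_children_r14
    (h9 : thm61_splitMultiplicative ∧ thm61_nonsplitMultiplicative ∧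
      (∀ (W : WeierstrassCurve ℚ) [W.IsElliptic] [W.IsGloballyMinimal] (p : ℕ) [Fact p.Prime],
        p ≠ 2 → greenberg_stevens (W := W) (p := p)) ∧
      Kato2004.thm12_4 ∧ exists_isNewformOf ∧
      Kato2004.exists_multDivisibilityInputs_nonsplit_contra ∧
      Kato2004.exists_multDivisibilityInputs_split_contra ∧
      Kato2004.exists_multDivisibilityInputs_fine_contra ∧ mazur_not_dvd_maninConstant_of_odd)
    (h9L : thm311_cotorsion_weightK_member_ofLevel_odd ∧ thm1_muAlg_of_weightK_member_ofLevel_odd ∧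
      Wan2015.thm4_rational_weightK_member_of_bdd_ofLevel_irred ∧
      thm513_transfer_from_weightK_member_of_bdd_ofLevel_odd ∧
      DeligneSerre1974.thm61_exists_adicGaloisRep ∧ Hida2000_thm326_ordinary ∧
      kato_charIdeal_dvd_multiplicative_of_surjective ∧
      rank_eq_analyticRank_of_analyticRank_le_one ∧
      thm12_not_le_normalizer_splitCartan)
    (hQ3 : cor514_transfer_of_goodOrdinary_odd ∧ YanZhu2026.thm49_charIdeal_eq_padicLFunction ∧
      thm1_muAlg_transfer_goodOrdinary_of_mult_odd)
    (h48 : Summit.BirchSwinnertonDyer.BirchSwinnertonDyer.Theses.ErratumRoadFive.NonSurjCornerTwinMuAn)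
    (hS : ∀ (W : WeierstrassCurve ℚ) [W.IsElliptic] [W.IsGloballyMinimal] (p : ℕ) [Fact p.Prime],
      ClassX11a W p → 5 ≤ p → Surj W p → ¬ X11a.ShaAnUnit W p → X11a.MuAnZeroAt W p)
    (hM : ∀ (W : WeierstrassCurve ℚ) [W.IsElliptic] [W.IsGloballyMinimal] (p : ℕ) [Fact p.Prime],
      ClassX11a W p → p = 3 → ¬ X11a.ShaAnUnit W p → ¬ p ∣ padicValInt p W.minimalDiscriminantInt → MemberRatEqAt W p)
    (hWu : Wuthrich2014.sha_dvd_analyticSha) :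
    Summit.BirchSwinnertonDyer.WAllCornerX11a := by
  obtain ⟨hL, -, -, hE⟩ := cruxes_of_children_r14 h9 h9L hQ3 h48 hS hM
  exact Summit.BirchSwinnertonDyer.BirchSwinnertonDyer.Theses.PrintX11a.closes hL hE ⟨hWu, h9L.2.2.2.2.2.2.2.1, h9.2.2.2.2.1⟩

end Summit.BirchSwinnertonDyer.BirchSwinnertonDyer.Theorems.PrintX11aLeaf

end
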